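import Literature.AlgebraicGeometry.Motives.HodgeLieWeilSquareLift
import Literature.AlgebraicGeometry.Motives.HodgeLieWeilThreeThreeLine
import HarnessLib

/-!
# The Weil square has no twist of type I: `W⁻ ≇ W⁺` as modules over the traceless Hodge-degree-zero algebra — brick S3-I of the (3|3) WEIL square

Family `hodge`, layer `Literature/AlgebraicGeometry/Motives`, namespace `Literature.AlgebraicGeometry.Motives.HodgeStructure`, sub-namespace
`WeilSquare`. THEOREMS ONLY (no definition, no named fact, no `sorry`). Written for the cell `pub-hodgeav-hg6` (req-37 (A) Q2b; eng-4 g7, brick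
S3-I of `HOME/jobs/WEIL33-eng4g7/DESIGN.md` REV 4 §5). HONEST FRAMING: nothing here proves HC / HC_AV / HC_CM; unconditional linear algebra of
polarized weight-one Hodge structures; no step towards a summit statement.

SETTING (`Motives/HodgeLieWeilSquareGoursat`): `H` effective polarized of weight `1` on `V` of dimension `12`, `φ ∈ End_Hdg(V)`, `φ² = −d`
(`d > 0`), `End_Hdg(V) = ℚ + ℚφ`, `μ² = −d`, `𝔷(𝔥) = 0`, `W = ker(φ_ℂ − μ)`, `W^± = W ∩ V^{1,0} / V^{0,1}` of dimension `3`, `𝔊⁰ ⊆ 𝔥_ℂ` the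
Hodge-degree-zero part, `𝔊⁰|_{W⁺} = End(W⁺)` (bricks S1). TWIST I = the second alternative of `WeilSquare.lift_or_twist`: an injective
`T : W⁻ → W⁺` with `X|_{W⁺} ∘ T = T ∘ X|_{W⁻}` for all `X ∈ 𝔊⁰` traceless on `W⁺`.

* §1 **`WeilSquare.smulRight_mem_of_ad_stable`** (linear algebra, any field of characteristic `0`, `dim U = 3`): a subspace
  `R ⊆ End(U)` stable under `A ↦ [Z, A]` for all traceless `Z` and containing a non-scalar element contains every rank-one nilpotent
  `ψ ⊗ w` (`ψ(w) = 0`) — `ad_X²(A) = −2X` for `X = φ ⊗ v` with `φ(v) = 0`, `φ(Av) = 1`, then two bracket steps.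
* §2 **`WeilSquare.false_of_twistOne`**: TWIST I is impossible. Transporting by `T`, the restrictions `Ñ = N|_{W⁻} ∘ T⁻¹ ∈ End(W⁺)` of the
  raising elements form an `ad 𝔰𝔩(W⁺)`-stable subspace `R̃` (brackets with `𝔊⁰`); the thin-corner brick B1
  (`WeilSquare.exists_raising_not_injective`, `8 ∤ 12`) gives a non-zero non-injective, hence NON-SCALAR, `Ñ₀ ∈ R̃`, so `R̃` contains all
  rank-one nilpotents (§1). For a raising `N` and the lowering `M₀ = B̄ ≠ 0`, `[N, M₀] ∈ 𝔊⁰ = 𝔇 ⊕ ℂΘ` and the twist give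
  `Ñ M̃₀ + M̃₀ Ñ ∈ ℂ·1` on `W⁺` (`M̃₀ = T ∘ M₀|_{W⁺}`); with `Ñ` running through the coordinate nilpotents `ε_i ⊗ e_j` of a basis this forces
  `M̃₀ = 0` — contradiction. (The genuine type-I model `𝔰𝔩₃ ⊗ 1 + 1 ⊗ 𝔰𝔩₂` on `U ⊗ ℂ²` has all raising elements invertible on `W⁻`,
  which is exactly what B1 excludes in dimension `12`.)

## References

* [Ribet1976RealMultiplications] K. A. Ribet, Amer. J. Math. 98 (1976), pp. 790–791.
* [Humphreys1972] J. E. Humphreys, *Introduction to Lie Algebras and Representation Theory* (1972), §2 Exercise 6, §19.2.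
* [MoonenZarhin1999LowDim] B. Moonen, Yu. Zarhin, Math. Ann. 315 (1999), §2 (2.3), §3 proof of Lemma (3.4).
* [Deligne1982HodgeCycles] P. Deligne, LNM 900 (1982), I §3 (proof of Prop. 3.4), §4 (p. 30).
-/

noncomputable section

open scoped TensorProduct

namespace Literature.AlgebraicGeometry.Motives

namespace HodgeStructure

universe u

variable {V : Type u} [AddCommGroup V] [Module ℚ V] [Module.Finite ℚ V] [HodgeTensorFacts.{u, u}] {n : ℤ}

/-! ### §0 Plumbing -/

omit [Module.Finite ℚ V] [HodgeTensorFacts.{u, u}] in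
/-- A functional separating `y ∉ Kx` from `x`. Private plumbing. [folklore] -/
private theorem WeilSquare.exists_dual_eq_one_eq_zero {K U : Type*} [Field K] [AddCommGroup U] [Module K U] {x y : U}
    (hy : y ∉ K ∙ x) : ∃ α : Module.Dual K U, α y = 1 ∧ α x = 0 := by
  obtain ⟨f, hfy, hfx⟩ := Submodule.exists_dual_map_eq_bot_of_notMem hy inferInstance
  have hfx0 : f x = 0 := by
    have h : f x ∈ Submodule.map f (K ∙ x) := Submodule.mem_map_of_mem (Submodule.mem_span_singleton_self x)
    rw [hfx] at h
    exact (Submodule.mem_bot K).1 h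
  refine ⟨(f y)⁻¹ • f, ?_, ?_⟩
  · rw [LinearMap.smul_apply, smul_eq_mul, inv_mul_cancel₀ hfy]
  · rw [LinearMap.smul_apply, hfx0, smul_zero]

omit [Module.Finite ℚ V] [HodgeTensorFacts.{u, u}] in
/-- The kernel of a non-zero functional on a `3`-space is a plane. Private plumbing. [folklore] -/
private theorem WeilSquare.finrank_ker_dual {K U : Type*} [Field K] [AddCommGroup U] [Module K U] [FiniteDimensional K U]
    (h3 : Module.finrank K U = 3) {φ : Module.Dual K U} (hφ : φ ≠ 0) : Module.finrank K ↥(LinearMap.ker φ) = 2 := by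
  obtain ⟨u, hu⟩ : ∃ u, φ u ≠ 0 := by
    by_contra h
    push Not at h
    exact hφ (LinearMap.ext h)
  have hrange : LinearMap.range φ = ⊤ := LinearMap.range_eq_top.2 fun c =>
    ⟨(c / φ u) • u, by rw [map_smul, smul_eq_mul, div_mul_cancel₀ c hu]⟩
  have h := LinearMap.finrank_range_add_finrank_ker φ
  rw [hrange, finrank_top, Module.finrank_self, h3] at h
  omega

/-! ### §1 A non-scalar element generates all rank-one nilpotents under `ad 𝔰𝔩(U)` -/

omit [Module.Finite ℚ V] [HodgeTensorFacts.{u, u}] in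
/-- **An `ad 𝔰𝔩(U)`-stable subspace of `End(U)` containing a non-scalar element contains every rank-one nilpotent** (`dim U = 3`,
characteristic `0`). With `φ(v) = 0`, `φ(Av) = 1` and `X = φ ⊗ v`: `ad_X²(A) = −2X ∈ R`; then `[ψ ⊗ w, φ ⊗ v] = φ ⊗ w` for
`w ∈ ker φ` (`ψ(v) = 1`, `ψ(w) = 0`), `[ψ ⊗ u, φ ⊗ w] = −φ(u) ψ ⊗ w` for `ψ(w) = ψ(u) = 0`, and every pair `(ψ′, v′)` with `ψ′(v′) = 0`
is reached through a common kernel vector of `φ` and `ψ′`. (The `ad 𝔰𝔩ₙ`-submodules of `𝔤𝔩ₙ`.) [cite: Humphreys1972, §2 Exercise 6]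
[cite: Ribet1976RealMultiplications, pp. 790–791] -/
theorem WeilSquare.smulRight_mem_of_ad_stable {K U : Type*} [Field K] [CharZero K] [AddCommGroup U] [Module K U]
    [FiniteDimensional K U] (h3 : Module.finrank K U = 3) {R : Submodule K (Module.End K U)}
    (hR : ∀ Z : Module.End K U, LinearMap.trace K U Z = 0 → ∀ A ∈ R, Z * A - A * Z ∈ R)
    {A : Module.End K U} (hA : A ∈ R) {v : U} (hv : A v ∉ K ∙ v) :
    ∀ (ψ : Module.Dual K U) (w : U), ψ w = 0 → ψ.smulRight w ∈ R := by
  have hv0 : v ≠ 0 := fun h => hv (by rw [h, map_zero]; exact Submodule.zero_mem _)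
  -- a rank-one nilpotent `X₀ = φ ⊗ v ∈ R`
  obtain ⟨φ, hφAv, hφv⟩ := WeilSquare.exists_dual_eq_one_eq_zero hv
  have hφ0 : φ ≠ 0 := fun h => by rw [h, LinearMap.zero_apply] at hφAv; exact zero_ne_one hφAv
  have hX₀ : φ.smulRight v ∈ R := by
    have htr : LinearMap.trace K U (φ.smulRight v) = 0 := by rw [LinearMap.trace_smulRight, hφv]
    have h1 := hR _ htr A hA
    have h2 := hR _ htr _ h1
    have heq : φ.smulRight v * (φ.smulRight v * A - A * φ.smulRight v) - (φ.smulRight v * A - A * φ.smulRight v) * φ.smulRight v =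
        (-2 : K) • φ.smulRight v := LinearMap.ext fun y => by
      simp only [LinearMap.sub_apply, Module.End.mul_apply, LinearMap.smulRight_apply, map_smul, map_sub, map_zero, hφv, hφAv,
        zero_smul, smul_zero, sub_zero, zero_sub, LinearMap.smul_apply]
      module
    rw [heq] at h2
    have h3 := R.smul_mem ((-2 : K)⁻¹) h2
    rwa [smul_smul, inv_mul_cancel₀ (by norm_num : (-2 : K) ≠ 0), one_smul] at h3
  -- step (i): move the vector inside `ker φ`
  have L1 : ∀ (φ : Module.Dual K U) (v : U), φ v = 0 → φ.smulRight v ∈ R → v ≠ 0 → ∀ w, φ w = 0 → φ.smulRight w ∈ R := by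
    intro φ v hφv hX hv0 w hφw
    by_cases hw : w ∈ K ∙ v
    · obtain ⟨c, rfl⟩ := Submodule.mem_span_singleton.1 hw
      have h : φ.smulRight (c • v) = c • φ.smulRight v := LinearMap.ext fun y => by
        rw [LinearMap.smulRight_apply, LinearMap.smul_apply, LinearMap.smulRight_apply, smul_comm]
      rw [h]
      exact R.smul_mem c hX
    · have hv' : v ∉ K ∙ w := by
        intro h
        obtain ⟨c, rfl⟩ := Submodule.mem_span_singleton.1 h
        rcases eq_or_ne c 0 with hc | hc
        · exact hv0 (by rw [hc, zero_smul])
        · exact hw (Submodule.mem_span_singleton.2 ⟨c⁻¹, by rw [smul_smul, inv_mul_cancel₀ hc, one_smul]⟩)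
      obtain ⟨ψ, hψv, hψw⟩ := WeilSquare.exists_dual_eq_one_eq_zero hv'
      have htr : LinearMap.trace K U (ψ.smulRight w) = 0 := by rw [LinearMap.trace_smulRight, hψw]
      have h := hR _ htr _ hX
      have heq : ψ.smulRight w * φ.smulRight v - φ.smulRight v * ψ.smulRight w = φ.smulRight w := LinearMap.ext fun y => by
        simp only [LinearMap.sub_apply, Module.End.mul_apply, LinearMap.smulRight_apply, map_smul, hψv, hφw, one_smul, zero_smul,
          smul_zero, sub_zero]
      rwa [heq] at h
  -- step (ii): change the functional, keeping the vector
  have L2 : ∀ (φ : Module.Dual K U) (w : U), φ w = 0 → φ ≠ 0 → φ.smulRight w ∈ R → ∀ ψ : Module.Dual K U, ψ w = 0 →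
      ψ.smulRight w ∈ R := by
    intro φ w hφw hφ0 hY ψ hψw
    by_cases hψ : ∃ c : K, ψ = c • φ
    · obtain ⟨c, rfl⟩ := hψ
      have h : (c • φ).smulRight w = c • φ.smulRight w := LinearMap.ext fun y => by
        rw [LinearMap.smulRight_apply, LinearMap.smul_apply, LinearMap.smul_apply, LinearMap.smulRight_apply, smul_eq_mul, mul_smul]
      rw [h]
      exact R.smul_mem c hY
    · obtain ⟨u, hψu, hφu⟩ : ∃ u, ψ u = 0 ∧ φ u ≠ 0 := by
        by_contra hcon
        push Not at hcon
        have hψ0 : ψ ≠ 0 := fun h => hψ ⟨0, by rw [h, zero_smul]⟩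
        obtain ⟨u₀, hu₀⟩ : ∃ u₀, ψ u₀ ≠ 0 := by
          by_contra h'
          push Not at h'
          exact hψ0 (LinearMap.ext h')
        have hφ : ∀ x, φ x = φ u₀ / ψ u₀ * ψ x := fun x => by
          have hx : ψ (x - (ψ x / ψ u₀) • u₀) = 0 := by rw [map_sub, map_smul, smul_eq_mul, div_mul_cancel₀ _ hu₀, sub_self]
          have h := hcon _ hx
          rw [map_sub, map_smul, smul_eq_mul, sub_eq_zero] at h
          rw [h]
          ring
        have hφu₀ : φ u₀ ≠ 0 := fun h0 => hφ0 (LinearMap.ext fun x => by rw [hφ x, h0, zero_div, zero_mul, LinearMap.zero_apply])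
        refine hψ ⟨ψ u₀ / φ u₀, LinearMap.ext fun x => ?_⟩
        rw [LinearMap.smul_apply, smul_eq_mul, hφ x]
        field_simp
      have htr : LinearMap.trace K U (ψ.smulRight u) = 0 := by rw [LinearMap.trace_smulRight, hψu]
      have h := hR _ htr _ hY
      have heq : ψ.smulRight u * φ.smulRight w - φ.smulRight w * ψ.smulRight u = (-φ u) • ψ.smulRight w := LinearMap.ext fun y => by
        simp only [LinearMap.sub_apply, Module.End.mul_apply, LinearMap.smulRight_apply, map_smul, hψw, smul_zero,
          zero_smul, zero_sub, LinearMap.smul_apply, LinearMap.neg_apply, neg_smul, smul_smul, mul_comm (ψ y) (φ u)]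
      rw [heq] at h
      have h3 := R.smul_mem ((-φ u)⁻¹) h
      rwa [smul_smul, inv_mul_cancel₀ (neg_ne_zero.2 hφu), one_smul] at h3
  -- step (iii): reach any `ψ′ ⊗ v′` through a common kernel vector of `φ` and `ψ′`
  intro ψ' v' hψ'v'
  by_cases hv'0 : v' = 0
  · rw [hv'0]
    have h : ψ'.smulRight (0 : U) = 0 := LinearMap.ext fun y => by rw [LinearMap.smulRight_apply, smul_zero, LinearMap.zero_apply]
    rw [h]
    exact R.zero_mem
  by_cases hψ'0 : ψ' = 0
  · rw [hψ'0]
    have h : (0 : Module.Dual K U).smulRight v' = 0 := LinearMap.ext fun y => by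
      rw [LinearMap.smulRight_apply, LinearMap.zero_apply, zero_smul, LinearMap.zero_apply]
    rw [h]
    exact R.zero_mem
  obtain ⟨w, hw0, hφw, hψ'w⟩ : ∃ w, w ≠ 0 ∧ φ w = 0 ∧ ψ' w = 0 := by
    have hk1 := WeilSquare.finrank_ker_dual h3 hφ0
    have hk2 := WeilSquare.finrank_ker_dual h3 hψ'0
    have hsum := Submodule.finrank_sup_add_finrank_inf_eq (LinearMap.ker φ) (LinearMap.ker ψ')
    have hle : Module.finrank K ↥(LinearMap.ker φ ⊔ LinearMap.ker ψ') ≤ 3 := h3 ▸ Submodule.finrank_le _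
    have hne : LinearMap.ker φ ⊓ LinearMap.ker ψ' ≠ ⊥ := fun h => by
      rw [h, finrank_bot, hk1, hk2] at hsum
      omega
    obtain ⟨w, hw, hw0⟩ := (Submodule.ne_bot_iff _).1 hne
    exact ⟨w, hw0, LinearMap.mem_ker.1 (Submodule.mem_inf.1 hw).1, LinearMap.mem_ker.1 (Submodule.mem_inf.1 hw).2⟩
  have h1 : φ.smulRight w ∈ R := L1 φ v hφv hX₀ hv0 w hφw
  have h2 : ψ'.smulRight w ∈ R := L2 φ w hφw hφ0 h1 ψ' hψ'w
  exact L1 ψ' w hψ'w h2 hw0 v' hψ'v'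

/-! ### §2 Twist I is impossible -/

set_option maxHeartbeats 4000000 in
/-- **The Weil square admits no twist of type I.** In the setting of `WeilSquare.lift_or_twist` on a `12`-dimensional `V` with
`End_Hdg(V) = ℚ + ℚφ`: there is NO injective `T : W⁻ → W⁺` with `X|_{W⁺} ∘ T = T ∘ X|_{W⁻}` for all `X ∈ 𝔊⁰` traceless on `W⁺`.
Transport by `T`: the `Ñ = N|_{W⁻} T⁻¹` (`N` raising) form an `ad 𝔰𝔩(W⁺)`-stable subspace containing the non-scalar `B̃` of the thin-corner
brick B1, hence all rank-one nilpotents (§1); `[N, B̄] ∈ 𝔇 ⊕ ℂΘ` transports to `Ñ M̃ + M̃ Ñ ∈ ℂ·1` (`M̃ = T B̄|_{W⁺} T… ≠ 0`), and the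
coordinate nilpotents `ε_i ⊗ e_j` force `M̃ = 0`. [cite: Ribet1976RealMultiplications, pp. 790–791]
[cite: MoonenZarhin1999LowDim, §3 (proof of Lemma (3.4))] [cite: Deligne1982HodgeCycles, I §3 (proof of Prop. 3.4)] -/
theorem WeilSquare.false_of_twistOne [Nontrivial V] (H : HodgeStructure V n) (hn : n = 1) (heff : H.IsEffective) (ψ : H.Polarization)
    {φ : Module.End ℚ V} (hφE : φ ∈ H.endAlg) {d : ℚ} (hd : 0 < d) (hφ2 : φ * φ = -(d • 1))
    (hE : ∀ a ∈ H.endAlg, ∃ x y : ℚ, a = x • 1 + y • φ) {μ : ℂ} (hμ : μ ^ 2 = -(d : ℂ))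
    (hz : H.hodgeLie ⊓ Subalgebra.toSubmodule H.endAlg = ⊥)
    (hWp : Module.finrank ℂ ↥(Module.End.eigenspace (φ.baseChange ℂ) μ ⊓ H.piece 1 0) = 3)
    (hWm : Module.finrank ℂ ↥(Module.End.eigenspace (φ.baseChange ℂ) μ ⊓ H.piece 0 1) = 3) (hV : Module.finrank ℚ V = 12)
    (hSp : ∀ F : Module.End ℂ ↥(Module.End.eigenspace (φ.baseChange ℂ) μ ⊓ H.piece 1 0),
      ∃ Y ∈ H.hodgeLieC, (∀ p ∈ H.piece 1 0, Y p ∈ H.piece 1 0) ∧ (∀ q ∈ H.piece 0 1, Y q ∈ H.piece 0 1) ∧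
        ∀ p : ↥(Module.End.eigenspace (φ.baseChange ℂ) μ ⊓ H.piece 1 0), Y p = F p) :
    ¬ ∃ T : ↥(Module.End.eigenspace (φ.baseChange ℂ) μ ⊓ H.piece 0 1) →ₗ[ℂ] ↥(Module.End.eigenspace (φ.baseChange ℂ) μ ⊓ H.piece 1 0),
      Function.Injective T ∧
        ∀ X ∈ H.hodgeLieC, (∀ p ∈ H.piece 1 0, X p ∈ H.piece 1 0) → (∀ q ∈ H.piece 0 1, X q ∈ H.piece 0 1) →
          ∀ (hXp : ∀ x ∈ Module.End.eigenspace (φ.baseChange ℂ) μ ⊓ H.piece 1 0, X x ∈ Module.End.eigenspace (φ.baseChange ℂ) μ ⊓ H.piece 1 0)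
            (hXm : ∀ x ∈ Module.End.eigenspace (φ.baseChange ℂ) μ ⊓ H.piece 0 1, X x ∈ Module.End.eigenspace (φ.baseChange ℂ) μ ⊓ H.piece 0 1),
            LinearMap.trace ℂ _ (X.restrict hXp) = 0 → X.restrict hXp ∘ₗ T = T ∘ₗ X.restrict hXm := by
  classical
  subst hn
  set W := Module.End.eigenspace (φ.baseChange ℂ) μ with hWdef
  set Wp := W ⊓ H.piece 1 0 with hWpdef
  set Wm := W ⊓ H.piece 0 1 with hWmdef
  rintro ⟨T, hTinj, hT⟩
  obtain ⟨hμ0, hμc⟩ := UnitaryTheta.conj_eq_neg_of_sq hd hμ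
  have hbrC : ∀ Y ∈ H.hodgeLieC, ∀ Z ∈ H.hodgeLieC, Y * Z - Z * Y ∈ H.hodgeLieC := fun Y hY Z hZ => H.commutator_mem_hodgeLieC hY hZ
  have hcφ : ∀ {X}, X ∈ H.hodgeLieC → X * φ.baseChange ℂ = φ.baseChange ℂ * X := fun {X} hX =>
    H.commute_baseChange_of_mem_hodgeLieC hX ⟨φ, hφE⟩
  have hXW : ∀ {X}, X ∈ H.hodgeLieC → ∀ w ∈ W, X w ∈ W := fun {X} hX w hw =>
    UnitaryTheta.apply_mem_eigenspace_of_commute (hcφ hX) hw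
  have hpres : ∀ {X}, X ∈ H.hodgeLieC → (∀ p ∈ H.piece 1 0, X p ∈ H.piece 1 0) → ∀ x ∈ Wp, X x ∈ Wp := fun {X} hX hXP x hx =>
    Submodule.mem_inf.2 ⟨hXW hX x (Submodule.mem_inf.1 hx).1, hXP x (Submodule.mem_inf.1 hx).2⟩
  have hpresm : ∀ {X}, X ∈ H.hodgeLieC → (∀ q ∈ H.piece 0 1, X q ∈ H.piece 0 1) → ∀ x ∈ Wm, X x ∈ Wm := fun {X} hX hXQ x hx =>
    Submodule.mem_inf.2 ⟨hXW hX x (Submodule.mem_inf.1 hx).1, hXQ x (Submodule.mem_inf.1 hx).2⟩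
  have hNWm : ∀ {N}, N ∈ H.hodgeLieC → (∀ v, N v ∈ H.piece 1 0) → ∀ x ∈ Wm, N x ∈ Wp := fun {N} hN hNim x hx =>
    Submodule.mem_inf.2 ⟨hXW hN x (Submodule.mem_inf.1 hx).1, hNim x⟩
  have hMWp : ∀ {M}, M ∈ H.hodgeLieC → (∀ v, M v ∈ H.piece 0 1) → ∀ x ∈ Wp, M x ∈ Wm := fun {M} hM hMim x hx =>
    Submodule.mem_inf.2 ⟨hXW hM x (Submodule.mem_inf.1 hx).1, hMim x⟩
  have hPQ : ∀ x ∈ H.piece 1 0, conj x ∈ H.piece 0 1 := fun x hx => conj_mem_piece H hx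
  have hQP : ∀ x ∈ H.piece 0 1, conj x ∈ H.piece 1 0 := fun x hx => conj_mem_piece H hx
  obtain ⟨Θ, hΘ⟩ := exists_hodgeTheta H
  obtain ⟨-, -, hΘ10, hΘ01, -⟩ := UnitaryTheta.theta_facts H rfl heff hΘ
  have hΘ𝔥 : Θ ∈ H.hodgeLieC := H.mem_hodgeLieC_of_forall_piece hΘ
  have hΘP : ∀ p ∈ H.piece 1 0, Θ p ∈ H.piece 1 0 := fun p hp => by rw [hΘ10 p hp]; exact hp
  have hΘQ : ∀ q ∈ H.piece 0 1, Θ q ∈ H.piece 0 1 := fun q hq => by rw [hΘ01 q hq]; exact Submodule.neg_mem _ hq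
  -- `T` is an isomorphism `Te : W⁻ ≃ W⁺`
  set Te : ↥Wm ≃ₗ[ℂ] ↥Wp := T.linearEquivOfInjective hTinj (by rw [hWm, hWp]) with hTedef
  have hTe : ∀ w, Te w = T w := fun w => LinearMap.linearEquivOfInjective_apply hTinj _ w
  -- the twist, transported: `X⁺ (Te w) = Te (X⁻ w)`
  have hconj : ∀ {X} (hX : X ∈ H.hodgeLieC) (hXP : ∀ p ∈ H.piece 1 0, X p ∈ H.piece 1 0)
      (hXQ : ∀ q ∈ H.piece 0 1, X q ∈ H.piece 0 1), LinearMap.trace ℂ _ (X.restrict (hpres hX hXP)) = 0 →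
      ∀ w : ↥Wm, X.restrict (hpres hX hXP) (Te w) = Te (X.restrict (hpresm hX hXQ) w) := by
    intro X hX hXP hXQ htr w
    have h := congrArg (fun f => f w) (hT X hX hXP hXQ (hpres hX hXP) (hpresm hX hXQ) htr)
    simp only [LinearMap.comp_apply] at h
    rw [hTe, hTe]
    exact h
  -- the thin-corner brick B1: a non-zero raising `B` with a kernel vector in `W⁻`
  obtain ⟨B, hB, hBP, hBim, hB0, w₀, hw₀, hw₀0, hBw₀⟩ :=
    WeilSquare.exists_raising_not_injective H rfl heff ψ hφE hd hφ2 hE hμ hz (m := 3) (by norm_num) hWp hWm (by rw [hV]; decide)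
  obtain ⟨w₁, hw₁, hBw₁⟩ : ∃ w₁ ∈ Wm, B w₁ ≠ 0 := by
    by_contra hcon
    push Not at hcon
    exact hB0 (WeilSquare.raising_eq_zero_of_forall_minus H rfl heff ψ hφE hd hφ2 hμ hB hBP hBim hcon)
  -- the lowering `M₀ = B̄`, non-zero on `W⁺`
  obtain ⟨M₀, hM₀⟩ := exists_conjOp B
  have hM₀𝔥 : M₀ ∈ H.hodgeLieC := by
    have hB' := hB
    rw [hodgeLieC_eq_spanC] at hB' ⊢
    exact conjOp_mem_spanC hB' hM₀
  have hM₀Q : ∀ q ∈ H.piece 0 1, M₀ q = 0 := fun q hq => by rw [hM₀, hBP _ (hQP q hq), map_zero]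
  have hM₀im : ∀ v, M₀ v ∈ H.piece 0 1 := fun v => by rw [hM₀]; exact hPQ _ (hBim _)
  obtain ⟨p₀, hp₀, hM₀p₀⟩ : ∃ p₀ ∈ Wp, M₀ p₀ ≠ 0 := by
    have hB1 : ∃ x ∈ Module.End.eigenspace (φ.baseChange ℂ) (-μ) ⊓ H.piece 0 1, B x ≠ 0 := by
      by_contra hcon
      push Not at hcon
      have hμ' : (-μ) ^ 2 = -(d : ℂ) := by rw [neg_sq]; exact hμ
      exact hB0 (WeilSquare.raising_eq_zero_of_forall_minus H rfl heff ψ hφE hd hφ2 hμ' hB hBP hBim hcon)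
    obtain ⟨x, hx, hBx⟩ := hB1
    refine ⟨conj x, Submodule.mem_inf.2 ⟨(UnitaryTheta.conj_mem_eigenspace_iff' φ hμc x).2 (Submodule.mem_inf.1 hx).1,
      hQP _ (Submodule.mem_inf.1 hx).2⟩, fun h0 => hBx ?_⟩
    rw [hM₀, conj_conj] at h0
    rw [← conj_conj (B x), h0, map_zero]
  set M₀r : ↥Wp →ₗ[ℂ] ↥Wm := M₀.restrict (hMWp hM₀𝔥 hM₀im) with hM₀rdef
  set Mt : Module.End ℂ ↥Wp := Te.toLinearMap ∘ₗ M₀r with hMtdef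
  have hMt0 : Mt ≠ 0 := by
    intro h0
    have h := congrArg (fun f : Module.End ℂ ↥Wp => ((Te.symm (f ⟨p₀, hp₀⟩) : ↥Wm) : ℂ ⊗[ℚ] V)) h0
    simp only [hMtdef, LinearMap.comp_apply, LinearEquiv.coe_coe, LinearEquiv.symm_apply_apply, LinearMap.zero_apply, map_zero,
      Submodule.coe_zero, hM₀rdef, LinearMap.coe_restrict_apply] at h
    exact hM₀p₀ h
  -- the transported raising restrictions `R̃ = {Ñ : Ñ (Te w) = N w}`
  let R : Submodule ℂ (Module.End ℂ ↥Wp) :=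
    { carrier := {A | ∃ N ∈ H.hodgeLieC, (∀ p ∈ H.piece 1 0, N p = 0) ∧ (∀ v, N v ∈ H.piece 1 0) ∧
        ∀ w : ↥Wm, ((A (Te w) : ↥Wp) : ℂ ⊗[ℚ] V) = N w}
      add_mem' := by
        rintro A A' ⟨N, hN, hNP, hNim, hA⟩ ⟨N', hN', hN'P, hN'im, hA'⟩
        refine ⟨N + N', H.hodgeLieC.add_mem hN hN', fun p hp => ?_, fun v => ?_, fun w => ?_⟩
        · rw [LinearMap.add_apply, hNP p hp, hN'P p hp, add_zero]
        · rw [LinearMap.add_apply]; exact Submodule.add_mem _ (hNim v) (hN'im v)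
        · rw [LinearMap.add_apply, Submodule.coe_add, hA, hA', LinearMap.add_apply]
      zero_mem' := ⟨0, H.hodgeLieC.zero_mem, fun p _ => rfl, fun v => Submodule.zero_mem _, fun w => rfl⟩
      smul_mem' := by
        rintro c A ⟨N, hN, hNP, hNim, hA⟩
        refine ⟨c • N, H.hodgeLieC.smul_mem c hN, fun p hp => ?_, fun v => ?_, fun w => ?_⟩
        · rw [LinearMap.smul_apply, hNP p hp, smul_zero]
        · rw [LinearMap.smul_apply]; exact Submodule.smul_mem _ _ (hNim v)
        · rw [LinearMap.smul_apply, Submodule.coe_smul, hA, LinearMap.smul_apply] }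
  have hmemR : ∀ A, A ∈ R ↔ ∃ N ∈ H.hodgeLieC, (∀ p ∈ H.piece 1 0, N p = 0) ∧ (∀ v, N v ∈ H.piece 1 0) ∧
      ∀ w : ↥Wm, ((A (Te w) : ↥Wp) : ℂ ⊗[ℚ] V) = N w := fun A => Iff.rfl
  -- `R̃` is `ad 𝔰𝔩(W⁺)`-stable
  have hRad : ∀ Z : Module.End ℂ ↥Wp, LinearMap.trace ℂ _ Z = 0 → ∀ A ∈ R, Z * A - A * Z ∈ R := by
    intro Z hZ A hA
    obtain ⟨N, hN, hNP, hNim, hAN⟩ := (hmemR A).1 hA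
    obtain ⟨X, hX, hXP, hXQ, hXZ⟩ := hSp Z
    have hres : X.restrict (hpres hX hXP) = Z := LinearMap.ext fun p => Subtype.ext (by rw [LinearMap.coe_restrict_apply]; exact hXZ p)
    have htr : LinearMap.trace ℂ _ (X.restrict (hpres hX hXP)) = 0 := by rw [hres]; exact hZ
    refine (hmemR _).2 ⟨X * N - N * X, hbrC X hX N hN, fun p hp => ?_, fun v => ?_, fun w => ?_⟩
    · rw [LinearMap.sub_apply, Module.End.mul_apply, Module.End.mul_apply, hNP p hp, map_zero, hNP _ (hXP p hp), sub_zero]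
    · rw [LinearMap.sub_apply, Module.End.mul_apply, Module.End.mul_apply]
      exact Submodule.sub_mem _ (hXP _ (hNim v)) (hNim _)
    · have h1 : ((Z (A (Te w)) : ↥Wp) : ℂ ⊗[ℚ] V) = X (N w) := by rw [← hXZ, hAN w]
      have h2 : Z (Te w) = Te (X.restrict (hpresm hX hXQ) w) := by rw [← hres]; exact hconj hX hXP hXQ htr w
      have h3 : ((A (Z (Te w)) : ↥Wp) : ℂ ⊗[ℚ] V) = N (X w) := by rw [h2, hAN, LinearMap.coe_restrict_apply]
      rw [LinearMap.sub_apply, Module.End.mul_apply, Module.End.mul_apply, Submodule.coe_sub, h1, h3, LinearMap.sub_apply,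
        Module.End.mul_apply, Module.End.mul_apply]
  -- the non-scalar element `B̃ ∈ R̃`
  set Br : ↥Wm →ₗ[ℂ] ↥Wp := B.restrict (hNWm hB hBim) with hBrdef
  set A₀ : Module.End ℂ ↥Wp := Br ∘ₗ Te.symm.toLinearMap with hA₀def
  have hA₀apply : ∀ w : ↥Wm, A₀ (Te w) = Br w := fun w => by
    rw [hA₀def, LinearMap.comp_apply, LinearEquiv.coe_coe, LinearEquiv.symm_apply_apply]
  have hA₀R : A₀ ∈ R := (hmemR A₀).2 ⟨B, hB, hBP, hBim, fun w => by rw [hA₀apply, hBrdef, LinearMap.coe_restrict_apply]⟩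
  set k : ↥Wp := Te ⟨w₀, hw₀⟩ with hkdef
  set u : ↥Wp := Te ⟨w₁, hw₁⟩ with hudef
  have hk0 : k ≠ 0 := fun h => hw₀0 (by
    have h' : (⟨w₀, hw₀⟩ : ↥Wm) = 0 := Te.injective (by rw [← hkdef, h, map_zero])
    exact congrArg Subtype.val h')
  have hA₀k : A₀ k = 0 := by
    rw [hkdef, hA₀apply]
    exact Subtype.ext (by rw [hBrdef, LinearMap.coe_restrict_apply, Submodule.coe_zero]; exact hBw₀)
  have hA₀u : A₀ u ≠ 0 := fun h => hBw₁ (by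
    have h' := congrArg Subtype.val h
    rw [hudef, hA₀apply, hBrdef, LinearMap.coe_restrict_apply, Submodule.coe_zero] at h'
    exact h')
  obtain ⟨v, hv⟩ : ∃ v : ↥Wp, A₀ v ∉ ℂ ∙ v := by
    by_cases hu : A₀ u ∈ ℂ ∙ u
    · obtain ⟨c, hc⟩ := Submodule.mem_span_singleton.1 hu
      have hc0 : c ≠ 0 := fun h => hA₀u (by rw [← hc, h, zero_smul])
      have hu0 : u ≠ 0 := fun h => hA₀u (by rw [h, map_zero])
      refine ⟨u + k, fun hmem => ?_⟩
      obtain ⟨c', hc'⟩ := Submodule.mem_span_singleton.1 hmem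
      rw [map_add, hA₀k, add_zero, ← hc, smul_add] at hc'
      -- `c' u + c' k = c u`: apply `A₀`
      have h2 := congrArg A₀ hc'
      rw [map_add, map_smul, map_smul, hA₀k, smul_zero, add_zero, map_smul, ← hc, smul_smul, smul_smul] at h2
      have hcc : c' = c := mul_right_cancel₀ hc0 (smul_left_injective ℂ hu0 h2)
      rw [hcc] at hc'
      have h5 : c • k = 0 := add_eq_left.1 hc'
      exact (smul_eq_zero.1 h5).elim hc0 hk0
    · exact ⟨u, hu⟩
  have hall : ∀ (χ : Module.Dual ℂ ↥Wp) (w : ↥Wp), χ w = 0 → χ.smulRight w ∈ R :=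
    WeilSquare.smulRight_mem_of_ad_stable hWp hRad hA₀R hv
  -- the anticommutator identity `Ñ M̃ + M̃ Ñ ∈ ℂ·1` for `Ñ ∈ R̃`
  have hanti : ∀ A ∈ R, ∃ c : ℂ, A * Mt + Mt * A = c • (1 : Module.End ℂ ↥Wp) := by
    intro A hA
    obtain ⟨N, hN, hNP, hNim, hAN⟩ := (hmemR A).1 hA
    set Rc : Module.End ℂ (ℂ ⊗[ℚ] V) := N * M₀ - M₀ * N with hRcdef
    have hRc𝔥 : Rc ∈ H.hodgeLieC := hbrC N hN M₀ hM₀𝔥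
    have hRcapply : ∀ v, Rc v = N (M₀ v) - M₀ (N v) := fun v => by
      rw [hRcdef, LinearMap.sub_apply, Module.End.mul_apply, Module.End.mul_apply]
    have hRcP : ∀ p ∈ H.piece 1 0, Rc p ∈ H.piece 1 0 := fun p hp => by
      rw [hRcapply, hNP p hp, map_zero, sub_zero]; exact hNim _
    have hRcQ : ∀ q ∈ H.piece 0 1, Rc q ∈ H.piece 0 1 := fun q hq => by
      rw [hRcapply, hM₀Q q hq, map_zero, zero_sub]; exact Submodule.neg_mem _ (hM₀im _)
    set c₀ : ℂ := (3 : ℂ)⁻¹ * LinearMap.trace ℂ _ (Rc.restrict (hpres hRc𝔥 hRcP)) with hc₀def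
    set D : Module.End ℂ (ℂ ⊗[ℚ] V) := Rc + (-c₀) • Θ with hDdef
    have hD𝔥 : D ∈ H.hodgeLieC := H.hodgeLieC.add_mem hRc𝔥 (H.hodgeLieC.smul_mem _ hΘ𝔥)
    have hDapply : ∀ v, D v = Rc v + (-c₀) • Θ v := fun v => by rw [hDdef, LinearMap.add_apply, LinearMap.smul_apply]
    have hDP : ∀ p ∈ H.piece 1 0, D p ∈ H.piece 1 0 := fun p hp => by
      rw [hDapply]; exact Submodule.add_mem _ (hRcP p hp) (Submodule.smul_mem _ _ (hΘP p hp))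
    have hDQ : ∀ q ∈ H.piece 0 1, D q ∈ H.piece 0 1 := fun q hq => by
      rw [hDapply]; exact Submodule.add_mem _ (hRcQ q hq) (Submodule.smul_mem _ _ (hΘQ q hq))
    have hΘres : Θ.restrict (hpres hΘ𝔥 hΘP) = (1 : Module.End ℂ ↥Wp) := LinearMap.ext fun p => Subtype.ext (by
      rw [LinearMap.coe_restrict_apply, Module.End.one_apply, hΘ10 _ (Submodule.mem_inf.1 p.2).2])
    have hDres : D.restrict (hpres hD𝔥 hDP) = Rc.restrict (hpres hRc𝔥 hRcP) + (-c₀) • (1 : Module.End ℂ ↥Wp) := by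
      rw [← hΘres]
      exact LinearMap.ext fun p => Subtype.ext (by
        simp only [LinearMap.coe_restrict_apply, LinearMap.add_apply, LinearMap.smul_apply, Submodule.coe_add, Submodule.coe_smul, hDapply])
    have htrD : LinearMap.trace ℂ _ (D.restrict (hpres hD𝔥 hDP)) = 0 := by
      rw [hDres, map_add, map_smul, LinearMap.trace_one, hWp, hc₀def, smul_eq_mul]
      push_cast
      ring
    obtain htw := hconj hD𝔥 hDP hDQ htrD
    refine ⟨2 * c₀, LinearMap.ext fun p => ?_⟩
    obtain ⟨w, rfl⟩ : ∃ w, Te w = p := Te.surjective p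
    -- `N (M₀ (Te w)) = A (Mt (Te w))` and `Te⟨M₀ (N w)⟩ = Mt (A (Te w))`
    have hMw : ((M₀r (Te w) : ↥Wm) : ℂ ⊗[ℚ] V) = M₀ (Te w : ℂ ⊗[ℚ] V) := by rw [hM₀rdef, LinearMap.coe_restrict_apply]
    have h1 : ((A (Mt (Te w)) : ↥Wp) : ℂ ⊗[ℚ] V) = N (M₀ (Te w : ℂ ⊗[ℚ] V)) := by
      rw [hMtdef, LinearMap.comp_apply, LinearEquiv.coe_coe, hAN, hMw]
    have hNw : (⟨N w, hNWm hN hNim w w.2⟩ : ↥Wp) = A (Te w) := Subtype.ext (by rw [hAN w])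
    have h2 : ((Te (M₀r (A (Te w))) : ↥Wp) : ℂ ⊗[ℚ] V) = ((Mt (A (Te w)) : ↥Wp) : ℂ ⊗[ℚ] V) := by
      rw [hMtdef, LinearMap.comp_apply, LinearEquiv.coe_coe]
    have hM₀Nw : (M₀r (A (Te w)) : ↥Wm) = ⟨M₀ (N w), hMWp hM₀𝔥 hM₀im _ (hNWm hN hNim w w.2)⟩ := Subtype.ext (by
      rw [hM₀rdef, LinearMap.coe_restrict_apply, ← hNw])
    -- evaluate the twist identity for `D` at `w`
    have h := congrArg (fun x : ↥Wp => (x : ℂ ⊗[ℚ] V)) (htw w)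
    simp only [LinearMap.coe_restrict_apply] at h
    -- left side: `D (Te w) = N (M₀ (Te w)) - c₀ Te w`
    have hL : D (Te w : ℂ ⊗[ℚ] V) = N (M₀ (Te w : ℂ ⊗[ℚ] V)) + (-c₀) • (Te w : ℂ ⊗[ℚ] V) := by
      rw [hDapply, hRcapply, hNP _ (Submodule.mem_inf.1 (Te w).2).2, map_zero, sub_zero, hΘ10 _ (Submodule.mem_inf.1 (Te w).2).2]
    -- right side: the element `D⁻ w` of `W⁻` is `-(M₀r (A (Te w))) + c₀ • w`
    have hRel : D.restrict (hpresm hD𝔥 hDQ) w = -(M₀r (A (Te w))) + c₀ • w := Subtype.ext (by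
      rw [LinearMap.coe_restrict_apply, Submodule.coe_add, Submodule.coe_neg, Submodule.coe_smul, hM₀Nw, hDapply, hRcapply,
        hM₀Q _ (Submodule.mem_inf.1 w.2).2, map_zero, zero_sub, hΘ01 _ (Submodule.mem_inf.1 w.2).2, smul_neg, neg_smul, neg_neg])
    rw [hRel, map_add, map_neg, map_smul, Submodule.coe_add, Submodule.coe_neg, Submodule.coe_smul, h2, hL] at h
    -- conclude `(A Mt + Mt A)(Te w) = 2 c₀ Te w`
    apply Subtype.ext
    rw [LinearMap.add_apply, Module.End.mul_apply, Module.End.mul_apply, Submodule.coe_add, h1, LinearMap.smul_apply,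
      Module.End.one_apply, Submodule.coe_smul, mul_smul, two_smul]
    have h' := h
    rw [neg_smul, ← sub_eq_add_neg, sub_eq_iff_eq_add] at h'
    rw [h']
    abel
  -- the coordinate nilpotents force `Mt = 0`
  set bp : Module.Basis (Fin 3) ℂ ↥Wp := Module.finBasisOfFinrankEq ℂ ↥Wp hWp with hbpdef
  have hcoord : ∀ i j : Fin 3, bp.coord i (bp j) = if j = i then 1 else 0 := fun i j => by
    rw [Module.Basis.coord_apply, Module.Basis.repr_self, Finsupp.single_apply]
  -- matrix entries `m i j = ε_i (Mt e_j)`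
  have hoff : ∀ i j : Fin 3, i ≠ j → bp.coord i (Mt (bp j)) = 0 ∧ Mt (bp j) = -(bp.coord i (Mt (bp i)) • bp j) := by
    intro i j hij
    obtain ⟨c, hc⟩ := hanti _ (hall (bp.coord i) (bp j) (by rw [hcoord, if_neg hij.symm]))
    have hcy : ∀ y : ↥Wp, bp.coord i (Mt y) • bp j + bp.coord i y • Mt (bp j) = c • y := fun y => by
      have h := congrArg (fun f : Module.End ℂ ↥Wp => f y) hc
      simp only [LinearMap.add_apply, Module.End.mul_apply, LinearMap.smulRight_apply, map_smul, LinearMap.smul_apply,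
        Module.End.one_apply] at h
      exact h
    -- a third index `l`
    obtain ⟨l, hli, hlj⟩ : ∃ l : Fin 3, l ≠ i ∧ l ≠ j := by
      fin_cases i <;> fin_cases j <;> simp at hij ⊢ <;> decide
    have hc0 : c = 0 := by
      have h := congrArg (fun y => bp.coord l y) (hcy (bp l))
      simp only [map_add, map_smul, hcoord, if_neg (Ne.symm hlj), if_neg hli, smul_eq_mul, mul_zero, zero_mul, add_zero,
        if_true, mul_one] at h
      exact h.symm
    have hjj : bp.coord i (Mt (bp j)) = 0 := by
      have h := congrArg (fun y => bp.coord j y) (hcy (bp j))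
      simp only [map_smul, hcoord, if_neg hij.symm, if_true, smul_eq_mul, mul_one, add_zero, hc0, zero_smul, map_zero] at h
      exact h
    refine ⟨hjj, ?_⟩
    have h := hcy (bp i)
    rw [hcoord, if_pos rfl, one_smul, hc0, zero_smul, add_eq_zero_iff_neg_eq, eq_comm] at h
    exact h
  have hMt : Mt = 0 := by
    have hdiag : ∀ i j : Fin 3, i ≠ j → bp.coord j (Mt (bp j)) = -(bp.coord i (Mt (bp i))) := fun i j hij => by
      have h := congrArg (fun y => bp.coord j y) (hoff i j hij).2
      simp only [map_smul, map_neg, hcoord, if_true, smul_eq_mul, mul_one] at h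
      exact h
    have h01 := hdiag 0 1 (by decide)
    have h12 := hdiag 1 2 (by decide)
    have h02 := hdiag 0 2 (by decide)
    have h00 : bp.coord 0 (Mt (bp 0)) = 0 := by
      have h : (2 : ℂ) * bp.coord 0 (Mt (bp 0)) = 0 := by linear_combination h01 - h12 + h02
      exact (mul_eq_zero.1 h).resolve_left two_ne_zero
    have hm0 : ∀ i : Fin 3, bp.coord i (Mt (bp i)) = 0 := fun i => by
      fin_cases i
      · exact h00
      · show bp.coord 1 (Mt (bp 1)) = 0
        rw [h01, h00, neg_zero]
      · show bp.coord 2 (Mt (bp 2)) = 0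
        rw [h02, h00, neg_zero]
    refine bp.ext fun j => ?_
    obtain ⟨i, hij⟩ : ∃ i : Fin 3, i ≠ j := ⟨j + 1, by fin_cases j <;> decide⟩
    rw [LinearMap.zero_apply, (hoff i j hij).2, hm0 i, zero_smul, neg_zero]
  exact hMt0 hMt

end HodgeStructure

end Literature.AlgebraicGeometry.Motives

end
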